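import Mathlib.Analysis.SpecialFunctions.Integrals.Basic
import Mathlib.MeasureTheory.Integral.IntervalIntegral.FundThmCalculus
import Literature.Geometry.Lorentzian.SelfSimilarVacuumProfile
import Literature.Geometry.Lorentzian.Geodesic
import HarnessLib

/-!
# The homothetic surface gravity of a self-similar vacuum profile at an invariant generator

Definition item `defn-homotheticSurfaceGravity` (topic `Literature/Geometry/Lorentzian`): the
objects posited by route `FinalStateConjecture/HomotheticSurfaceGravity` (card
`homothetic-surface-gravity-naked-point-v2`), needed to type its items `TransversalExponentLadder`,
`BenignProfileRigidity`, `HomotheticSurfaceGravityLaw`. No fact is asserted: this file only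
defines quantities attached to a `SelfSimilarVacuumProfile` (`SelfSimilarVacuumProfile.lean`:
discrete homothety `Φ = Z.dilation`, `Φ^* g = e^{2Δ} g`, `Δ = Z.logScale > 0`, optical function
`v = Z.coneFn`, vertex past cone `𝒩 = Z.cone = {v = 0}`, a smooth null hypersurface) and proves
their elementary API.

Let `γ₀` be a **generator** of `𝒩` (a future-directed affinely parametrised null geodesic lying
in `𝒩`; Galloway 2000, §2.1) which is **invariant** under the homothety, `Φ(γ₀) = γ₀`. Since a
homothety maps affinely parametrised geodesics to affinely parametrised geodesics and `Φ⁻¹`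
preserves the time orientation, `Φ⁻¹` acts on the affine parameter `u` of `γ₀` by an increasing
affine map; normalising `u ↑ 0` at the future (vertex) end, `Φ⁻¹(γ₀(u)) = γ₀(c₀ u)` with
`0 < c₀ < 1` — the **affine contraction** `c₀`. Transversally, `Φ⁻¹` contracts the area density
`A` of the generator congruence of `𝒩` along `γ₀` (Hawking–Ellis 1973, §4.2, (4.32) and §4.4,
p. 100: `θ̂ = (det Â)⁻¹ d(det Â)/dv` for the Jacobi matrix `Â` of the congruence, i.e.
`A' = θ A` with `θ` the null expansion) by `μ₀² = A(Φ⁻¹ x)/A(x)` — the **screen contraction**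
`μ₀`, equivalently `μ₀² = e^{-2Δ}/det dφ_{[γ₀]}` for the map `φ` induced by `Φ⁻¹` on the space of
generators at its fixed point `[γ₀]`. The **homothetic surface gravity** of `Z` at `γ₀` is the
ratio `α = log c₀ / log μ₀`. For Minkowski space minus a point (`Φ x = e^Δ x`) every generator
of the past light cone of the origin is invariant, `c₀ = μ₀ = e^{-Δ}` and `α = 1`. The
Killing-horizon analogue is Wald 1984, §12.5, (12.5.2)–(12.5.10): along the generators of a
Killing horizon the Killing flow rescales the affine parameter, `λ ∝ e^{κ v}`, at the rate given
by the surface gravity `κ`, while areas are preserved (`θ = 0`, (12.5.21)); for a *homothetic*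
horizon both the affine parameter and the area are rescaled, and — `𝓛_K g = 2g` admitting no
constant rescaling of `K`, unlike the Killing case — the ratio of the two logarithmic rates is an
absolute number.

## Contents (namespace `Literature.Geometry.Lorentzian.SelfSimilarVacuumProfile`, `Z` a profile)

* `coneGradient Z x = grad v = ♯(dv)` (O'Neill 1983, Ch. 3, Def. 3.47); on `𝒩` it is a null
  normal, hence a null *tangent*, of `𝒩`, spanning the null direction `L` of the structure axiom
  `exists_isNull_of_coneFn_eq_zero` (it is past-directed: `v` increases towards the future across
  `𝒩 = ∂{v < 0}`); `mvfderiv_coneFn_vectorField_ne_zero`: `dv(T) ≠ 0` on `𝒩` for the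
  time-orientation field `T`.
* `coneInaffinity Z x = κ`, the inaffinity of `grad v` on `𝒩`: `∇_{grad v} grad v = κ grad v`
  (the null normal of a null hypersurface is pre-geodesic, Galloway 2000, §2.1), read off against
  `T`: `κ = g(∇_{grad v} grad v, T) / dv(T)`.
* `coneExpansionGrad Z x = θ_{grad v}`, the **null expansion** (null mean curvature) of `𝒩` with
  respect to `grad v`: the trace of the null Weingarten map `b(X̄) = ∇_X (grad v) mod grad v` on
  `T_x𝒩 / ℝ grad v` (Galloway 2000, §2.1, `θ = tr b`; Wald 1984, (9.2.27), `θ = ĥ^{ab} B̂_{ab}`),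
  rendered through the identity `div (grad v) = θ_{grad v} + 2κ` on `𝒩` (see *Design*);
  `coneExpansion Z x ℓ = θ_ℓ = (g(ℓ,T)/dv(T)) θ_{grad v}` for a null tangent `ℓ = λ grad v`
  (`b_{fK} = f b_K`, Galloway 2000, §2.1), `coneExpansion_smul`.
* `IsConeGeneratorOn Z γ s`: on the parameter set `s`, `γ` is a geodesic of the Levi-Civita
  connection lying in `𝒩` with future-directed null velocity tangent to `𝒩` — an affinely
  parametrised future-directed null geodesic generator of `𝒩` (Galloway 2000, §2.1).
* `IsDilationContraction Z γ c`: `0 < c < 1` and `Φ⁻¹(γ u) = γ(c u)` for all `u < 0`;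
  `IsInvariantGenerator Z γ`: `γ` is a maximal geodesic with parameter domain `(-∞, 0)` (the
  vertex end at `u = 0`), a generator of `𝒩` there, injective, and `Φ⁻¹` acts on it by some
  dilation contraction; consequences `image_dilation_symm`, `image_dilation` (`Φ(γ₀) = γ₀`, the
  set form of invariance), `iterate_dilation_symm_apply` (`Φ^{-k}(γ u) = γ(c₀^k u)`).
* `affineContraction Z γ = c₀` (the `c` of `IsDilationContraction`, junk value `1`), with
  `affineContraction_eq` (uniqueness from injectivity), `affineContraction_pos/lt_one`.
* `expansionAlong Z γ t = θ_{γ'(t)}(γ t)`; `IsAreaDensityOn Z γ s A`: `A > 0` with `A' = θ A` on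
  `s` — `A` is an area density of the generator congruence of `𝒩` along `γ` in the parameter of
  `γ` (Hawking–Ellis 1973, (4.32): `dÂ/dv = K Â`, so `(det Â)' = θ̂ det Â`).
* `screenContraction Z γ = μ₀ := exp(½ ∫_{-1}^{-c₀} θ_{γ'} dt)`, so that
  `μ₀² = A(-c₀)/A(-1) = A(Φ⁻¹x)/A(x)` for `x = γ(-1)` and every area density `A`
  (`screenContraction_sq_eq_div`, by the fundamental theorem of calculus); `screenContraction_pos`.
* `homotheticSurfaceGravity Z γ = α := log c₀ / log μ₀` (`= 2 log c₀ / ∫_{-1}^{-c₀} θ_{γ'} dt`,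
  `homotheticSurfaceGravity_eq`).
* Sanity: `screenContraction_eq_affineContraction_of_expansionAlong_eq` and
  `homotheticSurfaceGravity_eq_one_of_expansionAlong_eq` — if the expansion along `γ` has the flat
  value `θ_{γ'(t)} = 2/t` (the past light cone of a point of Minkowski space in the affine
  parameter `t ↑ 0` at the vertex, area density `A ∝ t²`) then `μ₀ = c₀` and `α = 1`;
  `log_pow_div_log_pow`: `log(c^k)/log(μ^k) = log c / log μ` (`k ≠ 0`) — replacing `Φ` by `Φ^k`
  (log-scale `kΔ`) replaces `(c₀, μ₀)` by `(c₀^k, μ₀^k)` (`iterate_dilation_symm_apply`) and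
  leaves `α` unchanged.

## Design choices (what is *not* printed, and why it is rendered this way)

* **Invariance in parametrised form.** The request's `Φ '' range γ₀ = range γ₀` is, for a maximal
  future-directed affinely parametrised generator with vertex end at `u = 0`, equivalent to
  `Φ⁻¹ ∘ γ₀ = γ₀ ∘ (c₀ ·)` on `(-∞, 0)` for a unique `0 < c₀ < 1` (homotheties preserve the
  Levi-Civita connection, hence geodesics and their affine parameters, O'Neill 1983, Ch. 3,
  Lemma 3.64 and Remark 3.65 (1); `Φ⁻¹` preserves the time orientation,
  `preservesTimeOrientation_dilation_symm`, and fixes the vertex end). The tree has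
  geodesic uniqueness and affine reparametrisation only as named facts
  (`existsUnique_isMaximalGeodesicOn`, `IsGeodesicOn.comp_affine`), so the parametrised form is
  taken as the definition and the set form is *derived* (`IsInvariantGenerator.image_dilation`).
  The normalisation "domain `(-∞, 0)`" builds in finite future affine length of the generator (for
  generators of infinite future affine length the request asks for a junk value anyway); the past
  end is then automatically at `-∞` (the domain is invariant under `u ↦ u / c₀`).
* **The expansion through `div` and `κ`.** For the *gradient* null normal `ℓ = grad v` of
  `𝒩 = {v = 0}` one has on `𝒩`: `∇_ℓ ℓ = ½ grad(g(ℓ,ℓ)) = κ ℓ` (torsion-freeness and metric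
  compatibility; `g(ℓ,ℓ)` vanishes on `𝒩`, so its gradient is normal), i.e. `d(g(ℓ,ℓ)) = 2κ dv` on
  `𝒩`. In a null frame `(ℓ, N, e₁, e₂)` at `x ∈ 𝒩` (`g(ℓ,N) = -1`, `eᵢ` orthonormal in `T_x𝒩`) the
  trace of `X ↦ ∇_X ℓ` is `-g(N, ∇_ℓ ℓ) - g(ℓ, ∇_N ℓ) + Σᵢ g(eᵢ, ∇_{eᵢ} ℓ) = κ - ½ N(g(ℓ,ℓ)) + θ_ℓ
  = κ + κ + θ_ℓ`. Hence `θ_ℓ = div ℓ - 2κ`, with `div ℓ = tr ∇ℓ` (O'Neill 1983, Ch. 3, p. 86; the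
  tree's `PseudoRiemannianMetric.divVector`, here inlined as `LinearMap.trace` of `∇(grad v)` to
  keep the imports small) and `κ = g(∇_ℓ ℓ, T)/dv(T)` for any vector `T` with `dv(T) ≠ 0` — the
  time-orientation field qualifies (`mvfderiv_coneFn_vectorField_ne_zero`). This renders Galloway's
  `θ = tr b` without forming quotient spaces (whose very definition would need the invariance
  proofs `∇_X ℓ ∈ T𝒩` as data); for Minkowski space, `v = t + |x|` gives `ℓ = -∂_t + ∂_r`,
  `κ = 0`, `θ_ℓ = □v = 2/r`, and for the future-directed affine generator `γ(u) = (u, -u e)`,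
  `u < 0`, `θ_{γ'} = -θ_ℓ = 2/u` (negative: the past cone contracts towards its vertex, Galloway
  2000, §2.1), `A ∝ u²`, `μ₀ = c₀ = e^{-Δ}`.
* **Base point and normalisation of `μ₀`.** `A(Φ⁻¹x)/A(x) = exp ∫_x^{Φ⁻¹x} θ_{γ'} du` is
  independent of `x ∈ γ₀` and of the affine normalisation `u ↦ a u` because `θ` is
  `Φ`-equivariant (`θ_{dΦ⁻¹ℓ}(Φ⁻¹y) = θ_ℓ(y)`: areas scale by the constant `e^{-2Δ}`, which drops
  out of the logarithmic derivative) and `dΦ⁻¹ γ₀'(u) = c₀ γ₀'(c₀u)`. This equivariance is a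
  theorem about `hessian`/`leviCivita` under homotheties which the tree cannot yet prove, so the
  definition fixes the base point `x = γ₀(-1)` of the normalised parametrisation; statements
  needing another base point should carry the equivariance as a hypothesis.
* **Junk values.** `affineContraction = 1` (so `α = 0`) when no dilation contraction exists;
  `coneInaffinity`, `coneExpansion` are junk off `𝒩` and inherit the junk of `leviCivita` /
  `mvfderiv` at non-differentiable points; `μ₀ > 0` always.
* **Sanity checks are numerical.** Inhabiting `SelfSimilarVacuumProfile` by Minkowski space minus
  a point requires the vertex axiom `setOf_coneFn_neg_eq` for `ℝ⁴₁` (a causality computation not in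
  the tree), and the profile with dilation `Φ^k` requires re-deriving that axiom for `Φ^k`; so
  the two sanity statements of the request are proved at the level they are decidable here: given
  the flat value of the expansion along the generator, resp. as the invariance of `log c / log μ`
  under `(c, μ) ↦ (c^k, μ^k)` together with `Φ^{-k}(γ u) = γ(c₀^k u)`.
* **Relation to `NullConeGeneratorKinematics`** (sibling definition request, in flight when this
  file was written):
  its Jacobi area density along a generator is an `IsAreaDensityOn` witness, and
  `screenContraction_sq_eq_div` is the bridge `μ₀² = A(Φ⁻¹x)/A(x)`.
* The informal dictionary of the route card (spherical symmetry, `κ`-self-similar solutions of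
  Rodnianski–Shlapentokh-Rothman 2023, Def. 3.1, Christodoulou's `k`-family, …) is *not* vendored:
  those are claims of the route, not printed theorems.

## References

* G. J. Galloway, *Maximum principles for null hypersurfaces and null splitting theorems*, Ann.
  Henri Poincaré 1 (2000) 543–567 = arXiv:math/9909158, §2.1 (null Weingarten map `b_K`,
  `b_{fK} = f b_K`, null mean curvature `θ = tr b`, generators, Raychaudhuri equation).
* R. M. Wald, *General Relativity*, Univ. of Chicago Press 1984, §9.2, (9.2.25)–(9.2.27)
  (expansion of a null geodesic congruence, `θ = ĥ^{ab}B̂_{ab}`); §12.5, (12.5.2)–(12.5.10),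
  (12.5.21) (surface gravity of a Killing horizon; `λ ∝ e^{κv}` along the generators).
* S. W. Hawking, G. F. R. Ellis, *The large scale structure of space-time*, CUP 1973, §4.2,
  (4.30)–(4.35) (Jacobi fields of a null congruence, `dÂ/dv = KÂ`, null Raychaudhuri equation);
  §4.4, p. 100 (`θ̂ = (det Â)⁻¹ d(det Â)/dv`).
* B. O'Neill, *Semi-Riemannian geometry*, Academic Press 1983, Ch. 3, Def. 3.47 (gradient),
  p. 86 (divergence), Def. 3.19–3.20 (geodesics, affine parameter), Lemma 3.64 and Remark 3.65
  (homotheties preserve Levi-Civita connections, geodesics and causal character); Ch. 5,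
  Lemma 5.26.
* I. Rodnianski, Y. Shlapentokh-Rothman, *Naked singularities for the Einstein vacuum equations:
  the exterior solution*, Ann. of Math. 198 (2023) = arXiv:1912.08478, §1 (the singular point as
  the vertex of a regular past light cone; self-similar profiles).
* Nearest printed notion of a surface gravity for non-Killing (conformal/homothetic) horizons:
  C. C. Dyer, E. Honig, J. Math. Phys. 20 (1979) 409–412, doi:10.1063/1.523943; J. Sultana,
  C. C. Dyer, J. Math. Phys. 45 (2004) 4764–4776, doi:10.1063/1.1814417 (thermodynamic, for
  conformal Killing horizons; not used here).
-/

noncomputable section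

open Bundle Set Function Filter MeasureTheory intervalIntegral
open scoped Manifold ContDiff Topology

namespace Literature.Geometry.Lorentzian

namespace SelfSimilarVacuumProfile

universe u

variable {n : ℕ∞ω} [Fact (1 ≤ n)] (Z : SelfSimilarVacuumProfile.{u} n)

/-! ### The optical function at the cone: gradient, inaffinity, null expansion -/

/-- The **gradient of the optical function**, `grad v = ♯(dv)` (the vector field metrically
equivalent to `dv`). On the cone `𝒩 = {v = 0}` it is a null normal — hence a null tangent — of
`𝒩`, spanning the null direction `L` of `exists_isNull_of_coneFn_eq_zero` (`ker dv = L^⊥`).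
O'Neill 1983, Ch. 3, Def. 3.47. [cite: ONeill1983, Ch. 3, Def. 3.47] -/
def coneGradient (x : Z.carrier) : TangentSpace (𝓡 4) x :=
  Z.metric.sharp x (mvfderiv (𝓡 4) Z.coneFn x).toLinearMap

/-- Defining property of the gradient: `g(grad v, w) = dv(w)`. O'Neill 1983, Ch. 3, Def. 3.47. [cite: ONeill1983, Ch. 3, Def. 3.47] -/
@[simp] lemma val_coneGradient (x : Z.carrier) (w : TangentSpace (𝓡 4) x) :
    Z.metric.val x (Z.coneGradient x) w = mvfderiv (𝓡 4) Z.coneFn x w := by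
  simp [coneGradient]

/-- `mvfderiv` of the optical function is its `mfderiv` (values in `T ℝ = ℝ`). [folklore] -/
lemma mvfderiv_coneFn_apply (x : Z.carrier) (w : TangentSpace (𝓡 4) x) :
    mvfderiv (𝓡 4) Z.coneFn x w = mfderiv (𝓡 4) 𝓘(ℝ, ℝ) Z.coneFn x w := rfl

/-- **`dv(T) ≠ 0` on the cone** for the (timelike) time-orientation field `T`: `ker dv_x = L^⊥`
with `L` null, and a timelike vector is never orthogonal to a causal one (O'Neill 1983, Ch. 5,
Lemma 5.26). In particular `grad v ≠ 0` and `T` is transversal to `𝒩`. [cite: ONeill1983, Ch. 5, Lemma 5.26] -/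
theorem mvfderiv_coneFn_vectorField_ne_zero {x : Z.carrier} (hx : x ∈ Z.cone) :
    mvfderiv (𝓡 4) Z.coneFn x (Z.timeOrientation.vectorField x) ≠ 0 := by
  obtain ⟨L, hL, hker⟩ := Z.exists_isNull_of_coneFn_eq_zero x hx
  intro h0
  have h1 : Z.metric.val x L (Z.timeOrientation.vectorField x) = 0 :=
    (hker _).mp (by rw [← mvfderiv_coneFn_apply]; exact h0)
  rw [Z.metric.symm x] at h1
  exact Z.metric.val_ne_zero_of_isTimelike_of_isCausal (Z.timeOrientation.isTimelike x)
    hL.isCausal h1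

/-- The **inaffinity** `κ` of the gradient null normal on the cone: `∇_{grad v} grad v = κ grad v`
at the points of `𝒩` (the null normal field of a null hypersurface is pre-geodesic, Galloway
2000, §2.1; for the gradient normal, `∇_{grad v} grad v = ½ grad(g(grad v, grad v))` and
`g(grad v, grad v)` vanishes identically on `𝒩`, so this vector is normal to `𝒩`, i.e. a multiple
of `grad v`), read off against the time-orientation field `T` (transversal to `𝒩`,
`mvfderiv_coneFn_vectorField_ne_zero`):
`κ = g(∇_{grad v} grad v, T) / dv(T)`. Junk off the cone. Compare Wald 1984, (12.5.2)–(12.5.5)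
for the Killing normal of a Killing horizon. [cite: Galloway2000, §2.1] -/
def coneInaffinity (x : Z.carrier) : ℝ :=
  Z.metric.val x (Z.metric.leviCivita Z.coneGradient x (Z.coneGradient x))
      (Z.timeOrientation.vectorField x) /
    mvfderiv (𝓡 4) Z.coneFn x (Z.timeOrientation.vectorField x)

/-- The **null expansion (null mean curvature) of the cone with respect to `grad v`**:
`θ_{grad v} = tr b`, `b(X̄) = ∇_X grad v mod grad v` on `T_x𝒩 / ℝ grad v` (Galloway 2000, §2.1;
Wald 1984, (9.2.27), `θ = ĥ^{ab} B̂_{ab}`), rendered by the identity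
`θ_{grad v} = div(grad v) - 2κ` valid on `𝒩` for the gradient null normal (trace of `∇(grad v)`
in a null frame `(grad v, N, e₁, e₂)`: both null-diagonal entries equal `κ`; see the module
docstring). Junk off the cone. [cite: Galloway2000, §2.1] -/
def coneExpansionGrad (x : Z.carrier) : ℝ :=
  LinearMap.trace ℝ (TangentSpace (𝓡 4) x) (Z.metric.leviCivita Z.coneGradient x).toLinearMap -
    2 * Z.coneInaffinity x

/-- The **null expansion of the cone at `x` with respect to a null tangent `ℓ`** of `𝒩`
(`ℓ = λ grad v`, `λ = g(ℓ, T)/dv(T)`): `θ_ℓ = λ θ_{grad v}` — the null Weingarten map, hence its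
trace, is homogeneous of degree one in the null field, `b_{fK} = f b_K` (Galloway 2000, §2.1). For
`ℓ = γ'(u)` the velocity of an affinely parametrised generator this is the logarithmic rate of
change in `u` of the area density of the generator congruence (Hawking–Ellis 1973, §4.4, p. 100).
Meaningful for `x ∈ 𝒩` and `ℓ ∥ grad v`. [cite: Galloway2000, §2.1] -/
def coneExpansion (x : Z.carrier) (ℓ : TangentSpace (𝓡 4) x) : ℝ :=
  Z.metric.val x ℓ (Z.timeOrientation.vectorField x) /
      mvfderiv (𝓡 4) Z.coneFn x (Z.timeOrientation.vectorField x) * Z.coneExpansionGrad x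

/-- `θ_{a ℓ} = a θ_ℓ` (`b_{fK} = f b_K`). Galloway 2000, §2.1. [cite: Galloway2000, §2.1] -/
@[simp] lemma coneExpansion_smul (x : Z.carrier) (a : ℝ) (ℓ : TangentSpace (𝓡 4) x) :
    Z.coneExpansion x (a • ℓ) = a * Z.coneExpansion x ℓ := by
  simp only [coneExpansion, map_smul, FunLike.coe_smul, Pi.smul_apply, smul_eq_mul]
  ring

/-- `θ_{grad v} = coneExpansionGrad` on the cone (`λ = 1`). [folklore] -/
lemma coneExpansion_coneGradient {x : Z.carrier} (hx : x ∈ Z.cone) :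
    Z.coneExpansion x (Z.coneGradient x) = Z.coneExpansionGrad x := by
  rw [coneExpansion, val_coneGradient, div_self (Z.mvfderiv_coneFn_vectorField_ne_zero hx),
    one_mul]

/-! ### Generators of the cone and dilation-invariant generators -/

/-- `γ` is, on the parameter set `s`, an **affinely parametrised future-directed null geodesic
generator of the cone**: a geodesic of the Levi-Civita connection on `s` (`IsGeodesicOn`, so the
parameter is affine) lying in `𝒩`, whose velocity is null, future-directed and tangent to `𝒩`
(`dv(γ') = 0`; for a curve in `𝒩` this is the chain rule, recorded for convenience — a null
vector tangent to the null hypersurface `𝒩` is parallel to its null direction `grad v`).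
Galloway 2000, §2.1 ("the integral curves of `K`, when suitably parameterized, are null
geodesics … the null geodesic generators of `S`"). [cite: Galloway2000, §2.1] -/
def IsConeGeneratorOn (γ : ℝ → Z.carrier) (s : Set ℝ) : Prop :=
  IsGeodesicOn Z.metric.leviCivita γ s ∧ MapsTo γ s Z.cone ∧
    ∀ u ∈ s, Z.metric.IsNull (velocity (𝓡 4) γ u) ∧
      Z.timeOrientation.IsFutureDirected (velocity (𝓡 4) γ u) ∧
      mvfderiv (𝓡 4) Z.coneFn (γ u) (velocity (𝓡 4) γ u) = 0

namespace IsConeGeneratorOn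

variable {Z} {γ : ℝ → Z.carrier} {s : Set ℝ}

/-- A generator is a geodesic on its parameter set. [cite: Galloway2000, §2.1] -/
lemma isGeodesicOn (h : Z.IsConeGeneratorOn γ s) : IsGeodesicOn Z.metric.leviCivita γ s := h.1

/-- A generator lies in the cone. [cite: Galloway2000, §2.1] -/
lemma mapsTo (h : Z.IsConeGeneratorOn γ s) : MapsTo γ s Z.cone := h.2.1

/-- The velocity of a generator is null. [cite: Galloway2000, §2.1] -/
lemma isNull_velocity (h : Z.IsConeGeneratorOn γ s) {u : ℝ} (hu : u ∈ s) :
    Z.metric.IsNull (velocity (𝓡 4) γ u) := (h.2.2 u hu).1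

/-- The velocity of a generator is future-directed. [cite: Galloway2000, §2.1] -/
lemma isFutureDirected_velocity (h : Z.IsConeGeneratorOn γ s) {u : ℝ} (hu : u ∈ s) :
    Z.timeOrientation.IsFutureDirected (velocity (𝓡 4) γ u) := (h.2.2 u hu).2.1

/-- The velocity of a generator is tangent to the cone: `dv(γ') = 0`. [cite: Galloway2000, §2.1] -/
lemma mvfderiv_coneFn_velocity (h : Z.IsConeGeneratorOn γ s) {u : ℝ} (hu : u ∈ s) :
    mvfderiv (𝓡 4) Z.coneFn (γ u) (velocity (𝓡 4) γ u) = 0 := (h.2.2 u hu).2.2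

/-- Restriction of the parameter set. [folklore] -/
lemma mono (h : Z.IsConeGeneratorOn γ s) {s' : Set ℝ} (hs : s' ⊆ s) :
    Z.IsConeGeneratorOn γ s' :=
  ⟨h.1.mono hs, h.2.1.mono_left hs, fun u hu ↦ h.2.2 u (hs hu)⟩

end IsConeGeneratorOn

/-- `Φ⁻¹` **acts on the curve `γ` (parametrised by `(-∞, 0)`) as the dilation contraction
`u ↦ c u`** with `0 < c < 1`: `Φ⁻¹(γ u) = γ(c u)` for all `u < 0`. For an affinely parametrised
invariant generator with vertex end at `u = 0` this is the form the invariance `Φ(γ) = γ` takes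
(homotheties preserve Levi-Civita connections, hence map affinely parametrised geodesics to affinely
parametrised geodesics, O'Neill 1983, Ch. 3, Lemma 3.64 and Remark 3.65 (1); the orientation and
the vertex end are preserved); the Killing-horizon analogue
is `λ ↦ e^{κ v} λ`, Wald 1984, (12.5.9)–(12.5.10). Object posited by route
`FinalStateConjecture/HomotheticSurfaceGravity`. [folklore] -/
def IsDilationContraction (γ : ℝ → Z.carrier) (c : ℝ) : Prop :=
  0 < c ∧ c < 1 ∧ ∀ u : ℝ, u < 0 → Z.dilation.symm (γ u) = γ (c * u)

/-- `γ` is a **dilation-invariant generator of the vertex past cone, in normalised affine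
parametrisation**: `γ` is a maximal geodesic with parameter domain `(-∞, 0)` (so the affine
parameter increases to `0` at the future, vertex, end and the generator has finite future affine
length), an affinely parametrised future-directed null geodesic generator of `𝒩` there,
injective on `(-∞, 0)` (an embedded generator, so that the contraction ratio is determined by `γ`,
`affineContraction_eq`), and `Φ⁻¹` maps it to itself, acting by a dilation contraction
`u ↦ c₀ u`, `0 < c₀ < 1` (`IsDilationContraction`; the set form `Φ(γ((-∞,0))) = γ((-∞,0))` is
`IsInvariantGenerator.image_dilation`). Object posited by route
`FinalStateConjecture/HomotheticSurfaceGravity`; generators as in Galloway 2000, §2.1. [folklore] -/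
def IsInvariantGenerator (γ : ℝ → Z.carrier) : Prop :=
  IsMaximalGeodesicOn Z.metric.leviCivita γ (Iio 0) ∧ Z.IsConeGeneratorOn γ (Iio 0) ∧
    InjOn γ (Iio 0) ∧ ∃ c, Z.IsDilationContraction γ c

open scoped Classical in
/-- The **affine contraction** `c₀` of `Φ⁻¹` along `γ`: the ratio `0 < c₀ < 1` by which the
contraction `Φ⁻¹` rescales the normalised affine parameter of `γ`, `Φ⁻¹(γ u) = γ(c₀ u)`
(`IsDilationContraction`; unique when `γ` is injective on `(-∞,0)`, `affineContraction_eq`).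
Junk value `1` when `Φ⁻¹` does not act on `γ` by a dilation contraction. Object posited by
route `FinalStateConjecture/HomotheticSurfaceGravity`; Killing analogue Wald 1984, (12.5.10). [folklore] -/
def affineContraction (γ : ℝ → Z.carrier) : ℝ :=
  if h : ∃ c, Z.IsDilationContraction γ c then h.choose else 1

/-- The affine contraction has the defining property whenever some dilation contraction exists. [folklore] -/
lemma isDilationContraction_affineContraction {γ : ℝ → Z.carrier}
    (h : ∃ c, Z.IsDilationContraction γ c) : Z.IsDilationContraction γ (Z.affineContraction γ) := by
  rw [affineContraction, dif_pos h]
  exact h.choose_spec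

namespace IsDilationContraction

variable {Z} {γ : ℝ → Z.carrier} {c c' : ℝ}

/-- `0 < c`. [folklore] -/
lemma pos (h : Z.IsDilationContraction γ c) : 0 < c := h.1

/-- `c < 1`. [folklore] -/
lemma lt_one (h : Z.IsDilationContraction γ c) : c < 1 := h.2.1

/-- `Φ⁻¹(γ u) = γ(c u)` for `u < 0`. [folklore] -/
lemma dilation_symm_apply (h : Z.IsDilationContraction γ c) {u : ℝ} (hu : u < 0) :
    Z.dilation.symm (γ u) = γ (c * u) := h.2.2 u hu

/-- `c u < 0` for `u < 0`. [folklore] -/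
lemma mul_neg (h : Z.IsDilationContraction γ c) {u : ℝ} (hu : u < 0) : c * u < 0 :=
  mul_neg_of_pos_of_neg h.1 hu

/-- `Φ(γ(c u)) = γ u` for `u < 0`. [folklore] -/
lemma dilation_apply (h : Z.IsDilationContraction γ c) {u : ℝ} (hu : u < 0) :
    Z.dilation (γ (c * u)) = γ u := by
  rw [← h.dilation_symm_apply hu, Diffeomorph.apply_symm_apply]

/-- `Φ(γ u) = γ(u / c)` for `u < 0`: the dilation acts by the expansion `u ↦ u / c`. [folklore] -/
lemma dilation_apply' (h : Z.IsDilationContraction γ c) {u : ℝ} (hu : u < 0) :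
    Z.dilation (γ u) = γ (u / c) := by
  have hu' : u / c < 0 := div_neg_of_neg_of_pos hu h.1
  have := h.dilation_apply hu'
  rwa [mul_div_cancel₀ u h.1.ne'] at this

/-- **Iteration**: `Φ^{-k}(γ u) = γ(c^k u)` — replacing `Φ` by `Φ^k` replaces `c` by `c^k`.
Gundlach 1997, §2.2 (`(φ_*)^n g = e^{2nΔ} g`: the iterates of a discrete homothety are discrete
homotheties). [cite: Gundlach1997, §2.2] -/
lemma iterate_dilation_symm_apply (h : Z.IsDilationContraction γ c) (k : ℕ) {u : ℝ} (hu : u < 0) :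
    (Z.dilation.symm)^[k] (γ u) = γ (c ^ k * u) := by
  induction k with
  | zero => simp
  | succ k ih =>
    rw [iterate_succ_apply', ih, h.dilation_symm_apply (mul_neg_of_pos_of_neg (pow_pos h.1 k) hu),
      pow_succ]
    ring_nf

/-- `Φ⁻¹(γ((-∞,0))) = γ((-∞,0))`. [folklore] -/
lemma image_dilation_symm (h : Z.IsDilationContraction γ c) :
    Z.dilation.symm '' (γ '' Iio 0) = γ '' Iio 0 := by
  ext y
  simp only [mem_image, mem_Iio, exists_exists_and_eq_and]
  constructor
  · rintro ⟨u, hu, rfl⟩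
    exact ⟨c * u, h.mul_neg hu, (h.dilation_symm_apply hu).symm⟩
  · rintro ⟨u, hu, rfl⟩
    refine ⟨u / c, div_neg_of_neg_of_pos hu h.1, ?_⟩
    rw [h.dilation_symm_apply (div_neg_of_neg_of_pos hu h.1), mul_div_cancel₀ u h.1.ne']

/-- **Invariance, set form**: `Φ(γ((-∞,0))) = γ((-∞,0))` (the request's
`Φ '' range γ₀ = range γ₀` for the normalised parametrisation). [folklore] -/
lemma image_dilation (h : Z.IsDilationContraction γ c) :
    Z.dilation '' (γ '' Iio 0) = γ '' Iio 0 := by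
  conv_lhs => rw [← h.image_dilation_symm]
  rw [image_image]
  simp [Diffeomorph.apply_symm_apply]

/-- **Uniqueness of the contraction ratio** for a curve injective on `(-∞, 0)` (compare the
points `Φ⁻¹(γ(-1)) = γ(-c) = γ(-c')`). [folklore] -/
lemma unique (h : Z.IsDilationContraction γ c) (h' : Z.IsDilationContraction γ c')
    (hinj : InjOn γ (Iio 0)) : c = c' := by
  have h1 := h.dilation_symm_apply (u := -1) (by norm_num)
  have h2 := h'.dilation_symm_apply (u := -1) (by norm_num)
  rw [h1] at h2
  have := hinj (mem_Iio.mpr (h.mul_neg (by norm_num : (-1 : ℝ) < 0)))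
    (mem_Iio.mpr (h'.mul_neg (by norm_num : (-1 : ℝ) < 0))) h2
  linarith

end IsDilationContraction

variable {Z} in
/-- The affine contraction of a curve on which `Φ⁻¹` acts by the dilation contraction `c`, and
which is injective on `(-∞,0)`, is `c`. [folklore] -/
theorem affineContraction_eq {γ : ℝ → Z.carrier} {c : ℝ} (h : Z.IsDilationContraction γ c)
    (hinj : InjOn γ (Iio 0)) : Z.affineContraction γ = c :=
  (Z.isDilationContraction_affineContraction ⟨c, h⟩).unique h hinj

namespace IsInvariantGenerator

variable {Z} {γ : ℝ → Z.carrier}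

/-- An invariant generator is a maximal geodesic on `(-∞, 0)`. [folklore] -/
lemma isMaximalGeodesicOn (h : Z.IsInvariantGenerator γ) :
    IsMaximalGeodesicOn Z.metric.leviCivita γ (Iio 0) := h.1

/-- An invariant generator is a generator of the cone on `(-∞, 0)`. [folklore] -/
lemma isConeGeneratorOn (h : Z.IsInvariantGenerator γ) : Z.IsConeGeneratorOn γ (Iio 0) := h.2.1

/-- An invariant generator is injective on `(-∞, 0)`. [folklore] -/
lemma injOn (h : Z.IsInvariantGenerator γ) : InjOn γ (Iio 0) := h.2.2.1

/-- `Φ⁻¹` acts on an invariant generator by some dilation contraction. [folklore] -/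
lemma exists_isDilationContraction (h : Z.IsInvariantGenerator γ) :
    ∃ c, Z.IsDilationContraction γ c := h.2.2.2

/-- `Φ⁻¹` acts on an invariant generator by the dilation contraction `c₀ = affineContraction`. [folklore] -/
lemma isDilationContraction (h : Z.IsInvariantGenerator γ) :
    Z.IsDilationContraction γ (Z.affineContraction γ) :=
  Z.isDilationContraction_affineContraction h.exists_isDilationContraction

/-- `0 < c₀`. [folklore] -/
lemma affineContraction_pos (h : Z.IsInvariantGenerator γ) : 0 < Z.affineContraction γ :=
  h.isDilationContraction.pos

/-- `c₀ < 1`. [folklore] -/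
lemma affineContraction_lt_one (h : Z.IsInvariantGenerator γ) : Z.affineContraction γ < 1 :=
  h.isDilationContraction.lt_one

/-- `log c₀ < 0` (in particular `≠ 0`). [folklore] -/
lemma log_affineContraction_neg (h : Z.IsInvariantGenerator γ) :
    Real.log (Z.affineContraction γ) < 0 :=
  Real.log_neg h.affineContraction_pos h.affineContraction_lt_one

/-- `Φ⁻¹(γ u) = γ(c₀ u)` for `u < 0`. [folklore] -/
lemma dilation_symm_apply (h : Z.IsInvariantGenerator γ) {u : ℝ} (hu : u < 0) :
    Z.dilation.symm (γ u) = γ (Z.affineContraction γ * u) :=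
  h.isDilationContraction.dilation_symm_apply hu

/-- `Φ^{-k}(γ u) = γ(c₀^k u)` for `u < 0`. Gundlach 1997, §2.2. [cite: Gundlach1997, §2.2] -/
lemma iterate_dilation_symm_apply (h : Z.IsInvariantGenerator γ) (k : ℕ) {u : ℝ} (hu : u < 0) :
    (Z.dilation.symm)^[k] (γ u) = γ (Z.affineContraction γ ^ k * u) :=
  h.isDilationContraction.iterate_dilation_symm_apply k hu

/-- **Invariance, set form**: `Φ(γ((-∞,0))) = γ((-∞,0))`. [folklore] -/
lemma image_dilation (h : Z.IsInvariantGenerator γ) : Z.dilation '' (γ '' Iio 0) = γ '' Iio 0 :=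
  h.isDilationContraction.image_dilation

/-- An invariant generator lies in the cone. [folklore] -/
lemma mapsTo (h : Z.IsInvariantGenerator γ) : MapsTo γ (Iio 0) Z.cone := h.isConeGeneratorOn.mapsTo

end IsInvariantGenerator

/-! ### Expansion along a generator, area densities, the screen contraction -/

/-- The **expansion of the cone along the curve `γ` at parameter `t`**: `θ_{γ'(t)}(γ t)`, the null
expansion with respect to the velocity (for an affinely parametrised generator, the logarithmic
`t`-derivative of the area density of the generator congruence, Hawking–Ellis 1973, §4.4,
p. 100). [cite: HawkingEllis1973, §4.4, p. 100] -/
def expansionAlong (γ : ℝ → Z.carrier) (t : ℝ) : ℝ :=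
  Z.coneExpansion (γ t) (velocity (𝓡 4) γ t)

/-- `A` is an **area density of the generator congruence of the cone along `γ` on `s`**: `A` is
positive with logarithmic derivative the expansion, `A' = θ_{γ'} A`, on `s`. For a Jacobi matrix
`Â` of the congruence along an affinely parametrised generator, `dÂ/dv = K Â` (Hawking–Ellis
1973, (4.32)), so `A = det Â` (or any positive constant multiple, on a focal-point-free stretch)
qualifies: `θ̂ = (det Â)⁻¹ d(det Â)/dv` (ibid., §4.4, p. 100). [cite: HawkingEllis1973, §4.2 (4.32) and §4.4 p. 100] -/
def IsAreaDensityOn (γ : ℝ → Z.carrier) (s : Set ℝ) (A : ℝ → ℝ) : Prop :=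
  ∀ t ∈ s, 0 < A t ∧ HasDerivAt A (Z.expansionAlong γ t * A t) t

/-- The **screen contraction** `μ₀` of `Φ⁻¹` at the curve `γ`:
`μ₀ = exp(½ ∫_{-1}^{-c₀} θ_{γ'(t)}(γ t) dt)`, `c₀ = affineContraction`, so that
`μ₀² = A(-c₀)/A(-1) = A(Φ⁻¹x)/A(x)`, `x = γ(-1)`, for every area density `A` of the generator
congruence along `γ` (`screenContraction_sq_eq_div`): the linear rate at which `Φ⁻¹` contracts the
screen (space of generators) at the invariant generator, equivalently `μ₀² = e^{-2Δ}/det dφ_{[γ]}`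
for the map `φ` induced by `Φ⁻¹` on the space of generators at its fixed point. Base point `γ(-1)`
of the normalised parametrisation (independence of the base point is the `Φ`-equivariance of
`θ`, see the module docstring). Object posited by route
`FinalStateConjecture/HomotheticSurfaceGravity`; Killing analogue: `θ = 0`, `μ₀ = 1` on a Killing
horizon, Wald 1984, (12.5.21). [folklore] -/
def screenContraction (γ : ℝ → Z.carrier) : ℝ :=
  Real.exp ((∫ t in (-1 : ℝ)..(-Z.affineContraction γ), Z.expansionAlong γ t) / 2)

/-- `μ₀ > 0`. [folklore] -/
lemma screenContraction_pos (γ : ℝ → Z.carrier) : 0 < Z.screenContraction γ := Real.exp_pos _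

/-- `log μ₀ = ½ ∫_{-1}^{-c₀} θ_{γ'} dt`. [folklore] -/
lemma log_screenContraction (γ : ℝ → Z.carrier) :
    Real.log (Z.screenContraction γ) =
      (∫ t in (-1 : ℝ)..(-Z.affineContraction γ), Z.expansionAlong γ t) / 2 :=
  Real.log_exp _

/-- `μ₀² = exp ∫_{-1}^{-c₀} θ_{γ'} dt`. [folklore] -/
lemma screenContraction_sq (γ : ℝ → Z.carrier) :
    Z.screenContraction γ ^ 2 =
      Real.exp (∫ t in (-1 : ℝ)..(-Z.affineContraction γ), Z.expansionAlong γ t) := by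
  rw [screenContraction, sq, ← Real.exp_add]
  congr 1
  ring

variable {Z} in
/-- **`μ₀² = A(Φ⁻¹x)/A(x)`**: for every area density `A` of the generator congruence along `γ` on
the parameter interval `[-1, -c₀]` (with integrable expansion), `μ₀² = A(-c₀)/A(-1)` — the
fundamental theorem of calculus for `(log A)' = θ_{γ'}`. Hawking–Ellis 1973, §4.4, p. 100
(`θ̂ = d log det Â / dv`). [cite: HawkingEllis1973, §4.4, p. 100] -/
theorem screenContraction_sq_eq_div {γ : ℝ → Z.carrier} {A : ℝ → ℝ}
    (hA : Z.IsAreaDensityOn γ (uIcc (-1) (-Z.affineContraction γ)) A)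
    (hθ : IntervalIntegrable (Z.expansionAlong γ) volume (-1) (-Z.affineContraction γ)) :
    Z.screenContraction γ ^ 2 = A (-Z.affineContraction γ) / A (-1) := by
  have hderiv : ∀ t ∈ uIcc (-1 : ℝ) (-Z.affineContraction γ),
      HasDerivAt (fun t ↦ Real.log (A t)) (Z.expansionAlong γ t) t := by
    intro t ht
    obtain ⟨hpos, hA'⟩ := hA t ht
    refine ((Real.hasDerivAt_log hpos.ne').comp t hA').congr_deriv ?_
    rw [mul_comm (Z.expansionAlong γ t) (A t), ← mul_assoc, inv_mul_cancel₀ hpos.ne', one_mul]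
  have hl := (hA _ left_mem_uIcc).1
  have hr := (hA _ right_mem_uIcc).1
  rw [screenContraction_sq, integral_eq_sub_of_hasDerivAt hderiv hθ, Real.exp_sub,
    Real.exp_log hr, Real.exp_log hl]

/-! ### The homothetic surface gravity -/

/-- The **homothetic surface gravity** `α = log c₀ / log μ₀` of the profile `Z` at the
(dilation-invariant, normalised) generator `γ` of its vertex past cone: the ratio of the
logarithmic rates at which the contraction `Φ⁻¹` rescales the affine parameter of the generator
(`c₀ = affineContraction`) and the linear size of the screen (`μ₀ = screenContraction`). It is an
absolute number: `𝓛_K g = 2g` admits no constant rescaling of `K`, and replacing `Φ` by `Φ^k`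
replaces `(c₀, μ₀)` by `(c₀^k, μ₀^k)` (`log_pow_div_log_pow`); for Minkowski space minus a point
`α = 1` (`homotheticSurfaceGravity_eq_one_of_expansionAlong_eq`). Object posited by route
`FinalStateConjecture/HomotheticSurfaceGravity` (card `homothetic-surface-gravity-naked-point-v2`);
the Killing-horizon surface gravity it is modelled on is Wald 1984, §12.5, (12.5.2)–(12.5.10). [folklore] -/
def homotheticSurfaceGravity (γ : ℝ → Z.carrier) : ℝ :=
  Real.log (Z.affineContraction γ) / Real.log (Z.screenContraction γ)

/-- `α = 2 log c₀ / ∫_{-1}^{-c₀} θ_{γ'} dt`. [folklore] -/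
theorem homotheticSurfaceGravity_eq (γ : ℝ → Z.carrier) :
    Z.homotheticSurfaceGravity γ = 2 * Real.log (Z.affineContraction γ) /
      ∫ t in (-1 : ℝ)..(-Z.affineContraction γ), Z.expansionAlong γ t := by
  rw [homotheticSurfaceGravity, log_screenContraction, div_div_eq_mul_div, mul_comm]

/-- **Iteration leaves the exponent unchanged**: `log(c^k) / log(μ^k) = log c / log μ` for
`k ≠ 0` — with `iterate_dilation_symm_apply`, replacing the discrete homothety `Φ` (log-scale `Δ`)
by `Φ^k` (log-scale `kΔ`, Gundlach 1997, §2.2) replaces `(c₀, μ₀)` by `(c₀^k, μ₀^k)` and does not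
change `α`. [cite: Gundlach1997, §2.2] -/
theorem log_pow_div_log_pow (c μ : ℝ) {k : ℕ} (hk : k ≠ 0) :
    Real.log (c ^ k) / Real.log (μ ^ k) = Real.log c / Real.log μ := by
  rw [Real.log_pow, Real.log_pow]
  exact mul_div_mul_left _ _ (Nat.cast_ne_zero.mpr hk)

variable {Z} in
/-- **Flat sanity check, screen contraction.** If the expansion of the cone along `γ` has the
value of the past light cone of a point of Minkowski space in the affine parameter `t ↑ 0` at the
vertex, `θ_{γ'(t)} = 2/t` on `[-1, -c₀]` (area density `A ∝ t²`; the past cone has negative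
null mean curvature, Galloway 2000, §2.1), then `μ₀ = c₀` (`∫_{-1}^{-c₀} 2/t dt = 2 log c₀`). [cite: Galloway2000, §2.1] -/
theorem screenContraction_eq_affineContraction_of_expansionAlong_eq {γ : ℝ → Z.carrier}
    (hc : 0 < Z.affineContraction γ)
    (hθ : EqOn (Z.expansionAlong γ) (fun t ↦ 2 / t) (uIcc (-1) (-Z.affineContraction γ))) :
    Z.screenContraction γ = Z.affineContraction γ := by
  have hint : ∫ t in (-1 : ℝ)..(-Z.affineContraction γ), Z.expansionAlong γ t =
      2 * Real.log (Z.affineContraction γ) := by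
    rw [integral_congr hθ]
    have h2 : ∫ t in (-1 : ℝ)..(-Z.affineContraction γ), (2 : ℝ) / t =
        2 * ∫ t in (-1 : ℝ)..(-Z.affineContraction γ), t⁻¹ := by
      rw [← intervalIntegral.integral_const_mul]
      simp_rw [div_eq_mul_inv]
    rw [h2, integral_inv_of_neg (by norm_num) (by linarith), neg_div_neg_eq, div_one]
  rw [screenContraction, hint, mul_div_cancel_left₀ _ two_ne_zero, Real.exp_log hc]

variable {Z} in
/-- **Flat sanity check, surface gravity.** Under the flat value `θ_{γ'(t)} = 2/t` of the
expansion along an invariant generator `γ`, `α = 1` — the value for Minkowski space minus a point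
with `Φ x = e^Δ x`, where every generator of the past light cone of the origin is invariant with
`c₀ = μ₀ = e^{-Δ}`. [folklore] -/
theorem homotheticSurfaceGravity_eq_one_of_expansionAlong_eq {γ : ℝ → Z.carrier}
    (h : Z.IsInvariantGenerator γ)
    (hθ : EqOn (Z.expansionAlong γ) (fun t ↦ 2 / t) (uIcc (-1) (-Z.affineContraction γ))) :
    Z.homotheticSurfaceGravity γ = 1 := by
  rw [homotheticSurfaceGravity,
    screenContraction_eq_affineContraction_of_expansionAlong_eq h.affineContraction_pos hθ]
  exact div_self h.log_affineContraction_neg.ne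

end SelfSimilarVacuumProfile

end Literature.Geometry.Lorentzian

end
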